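import Summits.CriticalPhenomena.PercolationContinuityZ3.Theorems.PercNearOneGluingNoHeavyLowerTailCILScaledReferenceTools
import Literature.Probability.Percolation.LonelyClusterExchange
import HarnessLib

/-!
# `NoHeavyLowerTail` (stmt-CriticalPhenomena-4575) — set-champion stability is inherited from the configuration with an
# edge to a DOMINATED vertex deleted, up to the factor `1 − w(e)` ("port-edge convexity")

Support file (prover `prim-hp-3`, hull-port line, submodularity / LP-duality / Rayleigh-monotonicity seat;
`--supports stmt-CriticalPhenomena-4575`).  No definitions, no named facts, no sorries.

Notation: `μ_w = prodBernoulli w` on `Fin n`, relays `A`, level `j`, lightness `I_w(x) = μ_w{|π(x)| ≤ j}`; for an observer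
SET `O` and a vertex `q`, SET-CHAMPION STABILITY with margin
  `CS_w(O, q) := μ_w(q ↮ O, |π(q)| ≤ j) − μ_w(q ↮ O, 1 ≤ |π(O)| ≤ j)`
(`CS ≥ 0` is the inequality of `Literature.….observerSet_le_of_lonelier`, the two-sided kernel of the hull-port step when
`O = {s₁, s₂}`, cf. `Hyperedge.tps_of_overtaking`, `cil_twoPendantStars_of_TPS`).

* `HullPort.setCS_ge_erase_dominated_edge` — **for `y ∈ O`, a vertex `p` DOMINATED by `q` (`I_w(p) ≤ I_w(q)`), `q ≠ p`, and
  the pair `e = s(p, y)`:  `(1 − w(e)) · CS_{w[e ↦ 0]}(O, q) ≤ CS_w(O, q)`.**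
  Proof (three tree facts): every `μ_w`-probability is affine in `w(e)` (`HullPort.real_update_affine`), so
  `CS_w = (1 − w e)·CS_{w[e↦0]} + (w e)·CS_{w[e↦1]}`; raising the pair `e` — a pair AT the loser `p`, not containing `q` —
  keeps `I(p) ≤ I(q)` (`HullPort.lightness_le_of_raise_own_edge`, Rayleigh-type monotonicity), and under `w[e ↦ 1]` the member
  `y` has the lightness of `p` (`HullPort.lightness_eq_of_weight_one`), so `y` is a member of `O` no lighter than `q` and
  `CS_{w[e↦1]}(O, q) ≥ 0` by the lonely-cluster exchange (`observerSet_le_of_lonelier`, van den Berg–Häggström–Kahn Thm 1.5).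
  CONSEQUENCES for the two-pendant-stars kernel (crux notes HULLPORT-REF-gen3.md §2): with `O = {u₁,u₂}` and `p` a port of
  `u₁` dominated by `q` in `H`, the TPS margin satisfies `F ≥ (1 − a_p)·F^{−p}` (`F^{−p}` = the margin with the port edge
  `u₁–p` deleted, NO hypothesis needed there); so a minimal failure of the kernel would have to fail, by the factor
  `1/(1 − a_p)`, after deleting ANY dominated port edge; and the STAIRCASE criterion: if `q` dominates `p₁` in `H`, `p₂` in
  `H − e₁`, …, `p_m` in `H − e₁ − … − e_{m−1}` (the port edges of `u₁` in some order) and is a valid witness for `u₂` alone in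
  `H − star(u₁)`, then `CS_H({u₁,u₂}, q)`.
* `HullPort.setCS_nonneg_of_erase_dominated_edge` — the sign form: `CS_{w[e↦0]}(O, q) ≥ 0 ⇒ CS_w(O, q) ≥ 0`.
-/

noncomputable section

namespace Summit.CriticalPhenomena.PercolationContinuityZ3.Theorems

open MeasureTheory Set Literature.Probability.LatticeModels Literature.Probability.Percolation
open scoped Classical BigOperators

variable {n : ℕ}

namespace HullPort

/-- **Port-edge convexity of set-champion stability.**  Let `O` be a finite observer set, `y ∈ O`, and let `p, q` be
vertices with `q ≠ p`, `p ≠ y` and `I_w(p) ≤ I_w(q)` (`q` dominates `p`).  With `e = s(p, y)` and `w₀ = w[e ↦ 0]`: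
`(1 − w e) · CS_{w₀}(O, q) ≤ CS_w(O, q)`, where `CS_u(O, q) = μ_u(q ↮ O, |π(q)| ≤ j) − μ_u(q ↮ O, 1 ≤ |π(O)| ≤ j)`.
[cite: VandenbergHaggstromKahn2005, Thm. 1.5 (p. 7) — via `observerSet_le_of_lonelier`; this work] -/
theorem setCS_ge_erase_dominated_edge (w : Sym2 (Fin n) → unitInterval) (A O : Finset (Fin n)) (y p q : Fin n)
    (j : ℕ) (hy : y ∈ O) (hpy : p ≠ y) (hqp : q ≠ p)
    (hdom : (prodBernoulli w).real {ω : BondConfig (Fin n) | (A.filter fun z => ω ∈ openConn p z).card ≤ j} ≤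
      (prodBernoulli w).real {ω : BondConfig (Fin n) | (A.filter fun z => ω ∈ openConn q z).card ≤ j}) :
    (1 - (w s(p, y) : ℝ)) *
        ((prodBernoulli (Function.update w s(p, y) 0)).real {ω : BondConfig (Fin n) |
            (∀ x ∈ O, ω ∉ openConn q x) ∧ (A.filter fun z => ω ∈ openConn q z).card ≤ j} -
          (prodBernoulli (Function.update w s(p, y) 0)).real {ω : BondConfig (Fin n) |
            (∀ x ∈ O, ω ∉ openConn q x) ∧
              1 ≤ (A.filter fun z => ∃ x ∈ O, ω ∈ openConn x z).card ∧
              (A.filter fun z => ∃ x ∈ O, ω ∈ openConn x z).card ≤ j}) ≤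
      (prodBernoulli w).real {ω : BondConfig (Fin n) |
          (∀ x ∈ O, ω ∉ openConn q x) ∧ (A.filter fun z => ω ∈ openConn q z).card ≤ j} -
        (prodBernoulli w).real {ω : BondConfig (Fin n) |
          (∀ x ∈ O, ω ∉ openConn q x) ∧
            1 ≤ (A.filter fun z => ∃ x ∈ O, ω ∈ openConn x z).card ∧
            (A.filter fun z => ∃ x ∈ O, ω ∈ openConn x z).card ≤ j} := by
  set e : Sym2 (Fin n) := s(p, y) with he
  set R : Set (BondConfig (Fin n)) := {ω | (∀ x ∈ O, ω ∉ openConn q x) ∧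
    (A.filter fun z => ω ∈ openConn q z).card ≤ j} with hR
  set L : Set (BondConfig (Fin n)) := {ω | (∀ x ∈ O, ω ∉ openConn q x) ∧
    1 ≤ (A.filter fun z => ∃ x ∈ O, ω ∈ openConn x z).card ∧
    (A.filter fun z => ∃ x ∈ O, ω ∈ openConn x z).card ≤ j} with hL
  -- affinity in `w e`
  have hwe : Function.update w e (w e) = w := Function.update_eq_self e w
  have hR_aff := real_update_affine w e (w e) R
  have hL_aff := real_update_affine w e (w e) L
  rw [hwe] at hR_aff hL_aff
  -- at `w[e ↦ 1]`: `y` has the lightness of `p`, which stays dominated by `q`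
  have h1p : (prodBernoulli (Function.update w e 1)).real
        {ω : BondConfig (Fin n) | (A.filter fun z => ω ∈ openConn p z).card ≤ j} ≤
      (prodBernoulli (Function.update w e 1)).real
        {ω : BondConfig (Fin n) | (A.filter fun z => ω ∈ openConn q z).card ≤ j} := by
    have h := lightness_le_of_raise_own_edge w A p y q j hpy hqp (w e) 1 (by exact_mod_cast unitInterval.le_one (w e))
    rw [← he, hwe] at h
    exact h hdom
  have h1y : (prodBernoulli (Function.update w e 1)).real
        {ω : BondConfig (Fin n) | (A.filter fun z => ω ∈ openConn y z).card ≤ j} =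
      (prodBernoulli (Function.update w e 1)).real
        {ω : BondConfig (Fin n) | (A.filter fun z => ω ∈ openConn p z).card ≤ j} := by
    have hw1 : Function.update w e 1 s(y, p) = 1 := by
      rw [Sym2.eq_swap, ← he]; exact Function.update_self e 1 w
    exact lightness_eq_of_weight_one (Function.update w e 1) A hpy.symm j hw1
  have hCS1 : (prodBernoulli (Function.update w e 1)).real L ≤ (prodBernoulli (Function.update w e 1)).real R := by
    rw [hR, hL]
    have key := observerSet_le_of_lonelier (Function.update w e 1) A O y q hy j (by convert h1p using 3)
    convert key using 12
  have hwe0 : 0 ≤ (w e : ℝ) := by exact_mod_cast unitInterval.nonneg (w e)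
  rw [hR_aff, hL_aff]
  nlinarith

/-- **Sign form.**  In the setting of `setCS_ge_erase_dominated_edge`: if set-champion stability holds for `O` and `q` after the
pair `s(p, y)` is switched off (and `w s(p,y) < 1` is not even needed), then it holds for `w`.
[cite: VandenbergHaggstromKahn2005, Thm. 1.5 (p. 7) — via `observerSet_le_of_lonelier`; this work] -/
theorem setCS_nonneg_of_erase_dominated_edge (w : Sym2 (Fin n) → unitInterval) (A O : Finset (Fin n)) (y p q : Fin n)
    (j : ℕ) (hy : y ∈ O) (hpy : p ≠ y) (hqp : q ≠ p)
    (hdom : (prodBernoulli w).real {ω : BondConfig (Fin n) | (A.filter fun z => ω ∈ openConn p z).card ≤ j} ≤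
      (prodBernoulli w).real {ω : BondConfig (Fin n) | (A.filter fun z => ω ∈ openConn q z).card ≤ j})
    (h0 : (prodBernoulli (Function.update w s(p, y) 0)).real {ω : BondConfig (Fin n) |
            (∀ x ∈ O, ω ∉ openConn q x) ∧
              1 ≤ (A.filter fun z => ∃ x ∈ O, ω ∈ openConn x z).card ∧
              (A.filter fun z => ∃ x ∈ O, ω ∈ openConn x z).card ≤ j} ≤
      (prodBernoulli (Function.update w s(p, y) 0)).real {ω : BondConfig (Fin n) |
            (∀ x ∈ O, ω ∉ openConn q x) ∧ (A.filter fun z => ω ∈ openConn q z).card ≤ j}) :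
    (prodBernoulli w).real {ω : BondConfig (Fin n) |
          (∀ x ∈ O, ω ∉ openConn q x) ∧
            1 ≤ (A.filter fun z => ∃ x ∈ O, ω ∈ openConn x z).card ∧
            (A.filter fun z => ∃ x ∈ O, ω ∈ openConn x z).card ≤ j} ≤
      (prodBernoulli w).real {ω : BondConfig (Fin n) |
          (∀ x ∈ O, ω ∉ openConn q x) ∧ (A.filter fun z => ω ∈ openConn q z).card ≤ j} := by
  have h := setCS_ge_erase_dominated_edge w A O y p q j hy hpy hqp hdom
  have hwe1 : (w s(p, y) : ℝ) ≤ 1 := by exact_mod_cast unitInterval.le_one (w s(p, y))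
  nlinarith

end HullPort

end Summit.CriticalPhenomena.PercolationContinuityZ3.Theorems
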